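import Mathlib
import HarnessLib
import Literature.MathematicalPhysics.QuantumLattice.ScaleZeroMultiplierJoint
import Literature.MathematicalPhysics.QuantumLattice.HubbardUVSymbolFibreSampling

/-!
# Fibrewise envelopes of the scale-`0` field cutoff `M(x) = H₀(‖x‖)` on the frequency–band plane and of its band derivative and
# frequency translates — the multiplier twin of the `Ψ`-instances of `HubbardUVSymbolFibreSampling`

Topic `MathematicalPhysics/QuantumLattice`; continues `ScaleZeroMultiplierJoint` (p4: `bgmCutoff₂ e₀`, all mixed derivatives
`‖DⁿM‖ ≤ n!·B·(2/e₀)ⁿ`, support in the closed ball `‖x‖ ≤ e₀`) and `HubbardUVSymbolFibreSampling` (`FibreEnvBound Λ g k C σ`: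
`‖Dⁱg(x)‖ ≤ C·2/max(|x₀| − σ, Λ/2)`).  For the first space moments of the scale-`0` sector MULTIPLIER kernels
(Benfatto–Giuliani–Mastropietro 2006, §2.5 (2.45)–(2.48) with Lemma 2.2 (2.36aa); the band dependence telescoped over the frame pieces as
in §3 (3.2)–(3.8)) the telescoping machinery of `HubbardUVBandPieces` is generic in the plane function `g`; this file supplies its four
fibrewise inputs for the complexified cutoff `g = M` with `Λ = 2e₀` (the envelope `2/max(|x₀| − σ, e₀)` is the constant `2/e₀` on the
support and the derivatives vanish off it):

* `norm_iteratedFDeriv_bgmCutoffC_le`, `iteratedFDeriv_bgmCutoffC_eq_zero_of_gt`, `contDiff_bgmCutoffC` (complexified cutoff);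
* **`fibreEnvBound_bgmCutoffC`**, **`fibreEnvBound_fbDir_bgmCutoffC`**, **`fibreEnvBound_fbShiftSub_bgmCutoffC`**,
  **`fibreEnvBound_fbDir_fbShiftSub_bgmCutoffC`** (orders `k ≤ N`, `k+1 ≤ N`, `k+1 ≤ N`, `k+2 ≤ N`; `0 < e₀ ≤ 2`).

Everything is proved; no definitions, no named facts.

## Sources

G. Benfatto, A. Giuliani, V. Mastropietro, Ann. Henri Poincaré 7 (2006) 809–898, §2.2 (2.9), §2.5 (2.45)–(2.48), Lemma 2.2 (2.36aa),
§3 (3.2)–(3.8) (`BenfattoGiulianiMastropietro2006`).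
-/

noncomputable section

namespace Literature.MathematicalPhysics.QuantumLattice

open Real Set Literature.Probability.LatticeModels Literature.Analysis.Calculus
open scoped Nat

variable {e₀ : ℝ} {N : ℕ} {B : ℝ}

/-! ### §1 The complexified cutoff -/

/-- The complexified cutoff is smooth. [cite: BenfattoGiulianiMastropietro2006, §2.2 (2.9)] -/
theorem contDiff_bgmCutoffC (he : 0 < e₀) {n : ℕ∞} : ContDiff ℝ n (fun x : FreqBand => ((bgmCutoff₂ e₀ x : ℝ) : ℂ)) :=
  Complex.ofRealCLM.contDiff.comp (contDiff_bgmCutoff₂ he)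

/-- `‖Dⁿ M_ℂ(x)‖ ≤ n!·B·(2/e₀)ⁿ` (`n ≤ N`). [cite: BenfattoGiulianiMastropietro2006, Lemma 2.2 (2.36aa)] -/
theorem norm_iteratedFDeriv_bgmCutoffC_le (he : 0 < e₀) (hB1 : 1 ≤ B) (hB : ∀ i ≤ N, ∀ u, ‖iteratedDeriv i (bgmCutoffSqUnit e₀) u‖ ≤ B)
    {n : ℕ} (hn : n ≤ N) (x : FreqBand) :
    ‖iteratedFDeriv ℝ n (fun x : FreqBand => ((bgmCutoff₂ e₀ x : ℝ) : ℂ)) x‖ ≤ n ! * B * (2 / e₀) ^ n := by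
  rw [norm_iteratedFDeriv_ofReal_bgmCutoff₂ he]
  exact norm_iteratedFDeriv_bgmCutoff₂_le he hB1 hB hn x

/-- Off the closed ball all derivatives of `M_ℂ` vanish. [cite: BenfattoGiulianiMastropietro2006, §2.2 (2.9)] -/
theorem iteratedFDeriv_bgmCutoffC_eq_zero_of_gt (he : 0 < e₀) {x : FreqBand} (hx : e₀ < ‖x‖) (n : ℕ) :
    iteratedFDeriv ℝ n (fun x : FreqBand => ((bgmCutoff₂ e₀ x : ℝ) : ℂ)) x = 0 := by
  have h : ‖iteratedFDeriv ℝ n (fun x : FreqBand => ((bgmCutoff₂ e₀ x : ℝ) : ℂ)) x‖ = 0 := by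
    rw [norm_iteratedFDeriv_ofReal_bgmCutoff₂ he, iteratedFDeriv_bgmCutoff₂_eq_zero_of_gt he hx, norm_zero]
  exact norm_eq_zero.1 h

/-- Off the closed ball all derivatives of `∂_v M_ℂ` vanish. [cite: BenfattoGiulianiMastropietro2006, §2.2 (2.9)] -/
theorem iteratedFDeriv_fbDir_bgmCutoffC_eq_zero_of_gt (he : 0 < e₀) (v : FreqBand) {x : FreqBand} (hx : e₀ < ‖x‖) (n : ℕ) :
    iteratedFDeriv ℝ n (fbDir (fun x : FreqBand => ((bgmCutoff₂ e₀ x : ℝ) : ℂ)) v) x = 0 := by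
  have h := norm_iteratedFDeriv_fbDir_le n (contDiff_bgmCutoffC he) v x
  rw [iteratedFDeriv_bgmCutoffC_eq_zero_of_gt he hx, norm_zero, mul_zero] at h
  exact norm_eq_zero.1 (le_antisymm h (norm_nonneg _))

/-- `n!(2/e₀)ⁿ` is monotone in `n` for `e₀ ≤ 2`. [cite: BenfattoGiulianiMastropietro2006, Lemma 2.2 (2.36aa)] -/
theorem factorial_mul_pow_mono (he : 0 < e₀) (he2 : e₀ ≤ 2) (hB0 : 0 ≤ B) {i k : ℕ} (hik : i ≤ k) :
    (i ! : ℝ) * B * (2 / e₀) ^ i ≤ k ! * B * (2 / e₀) ^ k := by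
  have h1 : (1 : ℝ) ≤ 2 / e₀ := by rw [le_div_iff₀ he]; linarith
  have hf : (i ! : ℝ) ≤ k ! := by exact_mod_cast Nat.factorial_le hik
  exact mul_le_mul (mul_le_mul_of_nonneg_right hf hB0) (pow_le_pow_right₀ h1 hik) (by positivity) (by positivity)

/-- The coordinate of a frequency translate: `(x + δe₀)₀ = x₀ + δ`. [cite: BenfattoGiulianiMastropietro2006, (2.36aa)] -/
theorem apply_zero_add_smul_fbE0 (x : FreqBand) (δ : ℝ) : (x + δ • fbE0) 0 = x 0 + δ := by
  simp [fbE0]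

/-- If `|x₀| − |δ| > e₀` then both `x` and `x + δe₀` lie outside the closed ball of radius `e₀`. [cite: BenfattoGiulianiMastropietro2006, §2.2 (2.9)] -/
theorem lt_norm_and_lt_norm_shift_of_lt {x : FreqBand} {δ : ℝ} (h : e₀ < |x 0| - |δ|) : e₀ < ‖x‖ ∧ e₀ < ‖x + δ • fbE0‖ := by
  have hδ := abs_nonneg δ
  refine ⟨by linarith [abs_apply_zero_le_norm x], lt_of_lt_of_le ?_ (abs_apply_zero_le_norm (x + δ • fbE0))⟩
  rw [apply_zero_add_smul_fbE0]
  have := abs_sub_abs_le_abs_sub (x 0) (-δ)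
  rw [abs_neg, sub_neg_eq_add] at this
  linarith

/-- The envelope on the support: for `|x₀| − σ ≤ e₀` (`σ ≥ 0`), `C·2/max(|x₀| − σ, e₀) = C·(2/e₀)`… as an inequality usable both ways:
`K ≤ (e₀/2·K)·(2/max(|x₀| − σ, (2e₀)/2))` whenever `|x₀| − σ ≤ e₀` and `K ≥ 0`. [cite: BenfattoGiulianiMastropietro2006, (2.36aa)] -/
theorem le_envelope_of_le (he : 0 < e₀) {s : ℝ} (K : ℝ) (hs : s ≤ e₀) : K ≤ e₀ / 2 * K * (2 / max s (2 * e₀ / 2)) := by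
  rw [show 2 * e₀ / 2 = e₀ by ring, max_eq_right hs]
  field_simp
  exact le_rfl

/-! ### §2 The four fibrewise envelopes -/

/-- **The cutoff itself**: `FibreEnvBound (2e₀) M_ℂ k (e₀/2·k!·B·(2/e₀)ᵏ) 0` (`k ≤ N`, `0 < e₀ ≤ 2`).
[cite: BenfattoGiulianiMastropietro2006, Lemma 2.2 (2.36aa)] -/
theorem fibreEnvBound_bgmCutoffC (he : 0 < e₀) (he2 : e₀ ≤ 2) (hB1 : 1 ≤ B)
    (hB : ∀ i ≤ N, ∀ u, ‖iteratedDeriv i (bgmCutoffSqUnit e₀) u‖ ≤ B) {k : ℕ} (hk : k ≤ N) :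
    FibreEnvBound (2 * e₀) (fun x : FreqBand => ((bgmCutoff₂ e₀ x : ℝ) : ℂ)) k (e₀ / 2 * (k ! * B * (2 / e₀) ^ k)) 0 := by
  intro i hi x
  have hB0 : 0 ≤ B := zero_le_one.trans hB1
  rw [sub_zero]
  by_cases hx : |x 0| ≤ e₀
  · exact ((norm_iteratedFDeriv_bgmCutoffC_le he hB1 hB (hi.trans hk) x).trans (factorial_mul_pow_mono he he2 hB0 hi)).trans
      (le_envelope_of_le he _ hx)
  · have hx' : e₀ < ‖x‖ := lt_of_lt_of_le (lt_of_not_ge hx) (abs_apply_zero_le_norm x)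
    rw [iteratedFDeriv_bgmCutoffC_eq_zero_of_gt he hx', norm_zero]
    have : 0 < max (|x 0|) (2 * e₀ / 2) := lt_max_of_lt_right (by linarith)
    positivity

/-- **The band derivative**: `FibreEnvBound (2e₀) (∂_v M_ℂ) k (‖v‖·e₀/2·(k+1)!·B·(2/e₀)^{k+1}) 0` (`k + 1 ≤ N`).
[cite: BenfattoGiulianiMastropietro2006, Lemma 2.2 (2.36aa)] -/
theorem fibreEnvBound_fbDir_bgmCutoffC (he : 0 < e₀) (he2 : e₀ ≤ 2) (hB1 : 1 ≤ B)
    (hB : ∀ i ≤ N, ∀ u, ‖iteratedDeriv i (bgmCutoffSqUnit e₀) u‖ ≤ B) {k : ℕ} (hk : k + 1 ≤ N) (v : FreqBand) :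
    FibreEnvBound (2 * e₀) (fbDir (fun x : FreqBand => ((bgmCutoff₂ e₀ x : ℝ) : ℂ)) v) k
      (‖v‖ * (e₀ / 2 * ((k + 1) ! * B * (2 / e₀) ^ (k + 1)))) 0 := by
  intro i hi x
  have hB0 : 0 ≤ B := zero_le_one.trans hB1
  rw [sub_zero]
  by_cases hx : |x 0| ≤ e₀
  · have h1 := norm_iteratedFDeriv_fbDir_le i (contDiff_bgmCutoffC he) v x
    have h2 := norm_iteratedFDeriv_bgmCutoffC_le he hB1 hB (n := i + 1) (by omega) x
    have h3 := factorial_mul_pow_mono he he2 hB0 (i := i + 1) (k := k + 1) (by omega)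
    calc _ ≤ ‖v‖ * ((k + 1) ! * B * (2 / e₀) ^ (k + 1)) := h1.trans (mul_le_mul_of_nonneg_left (h2.trans (by exact_mod_cast h3)) (norm_nonneg _))
      _ ≤ e₀ / 2 * (‖v‖ * ((k + 1) ! * B * (2 / e₀) ^ (k + 1))) * (2 / max (|x 0|) (2 * e₀ / 2)) :=
          le_envelope_of_le he _ hx
      _ = _ := by ring
  · have hx' : e₀ < ‖x‖ := lt_of_lt_of_le (lt_of_not_ge hx) (abs_apply_zero_le_norm x)
    rw [iteratedFDeriv_fbDir_bgmCutoffC_eq_zero_of_gt he v hx', norm_zero]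
    have : 0 < max (|x 0|) (2 * e₀ / 2) := lt_max_of_lt_right (by linarith)
    positivity

/-- **The frequency translate**: `FibreEnvBound (2e₀) (M_ℂ(·+δe₀) − M_ℂ) k (|δ|·e₀/2·(k+1)!·B·(2/e₀)^{k+1}) |δ|` (`k + 1 ≤ N`).
[cite: BenfattoGiulianiMastropietro2006, §2.1 Lemma 2.2] -/
theorem fibreEnvBound_fbShiftSub_bgmCutoffC (he : 0 < e₀) (he2 : e₀ ≤ 2) (hB1 : 1 ≤ B)
    (hB : ∀ i ≤ N, ∀ u, ‖iteratedDeriv i (bgmCutoffSqUnit e₀) u‖ ≤ B) {k : ℕ} (hk : k + 1 ≤ N) (δ : ℝ) :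
    FibreEnvBound (2 * e₀) (fbShiftSub (fun x : FreqBand => ((bgmCutoff₂ e₀ x : ℝ) : ℂ)) δ) k
      (|δ| * (e₀ / 2 * ((k + 1) ! * B * (2 / e₀) ^ (k + 1)))) |δ| := by
  intro i hi x
  have hB0 : 0 ≤ B := zero_le_one.trans hB1
  have he' : 0 < 2 * e₀ := by linarith
  rw [iteratedFDeriv_fbShiftSub (contDiff_bgmCutoffC he) δ x]
  by_cases hx : |x 0| - |δ| ≤ e₀
  · -- mean value along the segment with the constant envelope (`p = 0`)
    have hseg := norm_iteratedFDeriv_sub_shift_le_of_envelope he' (g := fun x : FreqBand => ((bgmCutoff₂ e₀ x : ℝ) : ℂ)) (i := i)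
      (contDiff_bgmCutoffC he) (P := (i + 1) ! * B * (2 / e₀) ^ (i + 1)) (by positivity) (p := 0)
      (fun y => by rw [pow_zero, mul_one]; exact norm_iteratedFDeriv_bgmCutoffC_le he hB1 hB (by omega) y) δ x
    rw [pow_zero, mul_one] at hseg
    have h3 := factorial_mul_pow_mono he he2 hB0 (i := i + 1) (k := k + 1) (by omega)
    calc _ ≤ |δ| * ((k + 1) ! * B * (2 / e₀) ^ (k + 1)) := hseg.trans (mul_le_mul_of_nonneg_left (by exact_mod_cast h3) (abs_nonneg _))
      _ ≤ e₀ / 2 * (|δ| * ((k + 1) ! * B * (2 / e₀) ^ (k + 1))) * (2 / max (|x 0| - |δ|) (2 * e₀ / 2)) :=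
          le_envelope_of_le he _ hx
      _ = _ := by ring
  · obtain ⟨h1, h2⟩ := lt_norm_and_lt_norm_shift_of_lt (lt_of_not_ge hx)
    rw [iteratedFDeriv_bgmCutoffC_eq_zero_of_gt he h2, iteratedFDeriv_bgmCutoffC_eq_zero_of_gt he h1, sub_zero, norm_zero]
    have : 0 < max (|x 0| - |δ|) (2 * e₀ / 2) := lt_max_of_lt_right (by linarith)
    positivity

/-- **The band derivative of the frequency translate**: `FibreEnvBound (2e₀) (∂_v(M_ℂ(·+δe₀) − M_ℂ)) k (|δ|·‖v‖·e₀/2·(k+2)!·B·(2/e₀)^{k+2}) |δ|`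
(`k + 2 ≤ N`). [cite: BenfattoGiulianiMastropietro2006, §2.1 Lemma 2.2] -/
theorem fibreEnvBound_fbDir_fbShiftSub_bgmCutoffC (he : 0 < e₀) (he2 : e₀ ≤ 2) (hB1 : 1 ≤ B)
    (hB : ∀ i ≤ N, ∀ u, ‖iteratedDeriv i (bgmCutoffSqUnit e₀) u‖ ≤ B) {k : ℕ} (hk : k + 2 ≤ N) (δ : ℝ) (v : FreqBand) :
    FibreEnvBound (2 * e₀) (fbDir (fbShiftSub (fun x : FreqBand => ((bgmCutoff₂ e₀ x : ℝ) : ℂ)) δ) v) k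
      (|δ| * ‖v‖ * (e₀ / 2 * ((k + 2) ! * B * (2 / e₀) ^ (k + 2)))) |δ| := by
  intro i hi x
  have hB0 : 0 ≤ B := zero_le_one.trans hB1
  have he' : 0 < 2 * e₀ := by linarith
  set g := fun x : FreqBand => ((bgmCutoff₂ e₀ x : ℝ) : ℂ) with hg
  have hdg : Differentiable ℝ g := (contDiff_bgmCutoffC he (n := 1)).differentiable one_ne_zero
  have hcd : ContDiff ℝ (↑(i + 1 : ℕ)) (fbDir g v) := contDiff_fbDir (contDiff_bgmCutoffC he (n := (i + 1 : ℕ) + 1)) v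
  rw [fbDir_fbShiftSub hdg, iteratedFDeriv_fbShiftSub (hcd.of_le (by exact_mod_cast Nat.le_succ i)) δ x]
  by_cases hx : |x 0| - |δ| ≤ e₀
  · have hP : ∀ y : FreqBand, ‖iteratedFDeriv ℝ (i + 1) (fbDir g v) y‖ ≤ ‖v‖ * ((i + 2) ! * B * (2 / e₀) ^ (i + 2)) * (2 / max |y 0| (2 * e₀ / 2)) ^ 0 := by
      intro y
      rw [pow_zero, mul_one]
      have h1 := norm_iteratedFDeriv_fbDir_le (i + 1) (contDiff_bgmCutoffC he) v y
      have h2 := norm_iteratedFDeriv_bgmCutoffC_le he hB1 hB (n := i + 1 + 1) (by omega) y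
      rw [show i + 1 + 1 = i + 2 by ring] at h2
      exact h1.trans (mul_le_mul_of_nonneg_left (by exact_mod_cast h2) (norm_nonneg _))
    have hseg := norm_iteratedFDeriv_sub_shift_le_of_envelope he' (g := fbDir g v) (i := i) hcd (by positivity) hP δ x
    rw [pow_zero, mul_one] at hseg
    have h3 := factorial_mul_pow_mono he he2 hB0 (i := i + 2) (k := k + 2) (by omega)
    calc _ ≤ |δ| * (‖v‖ * ((k + 2) ! * B * (2 / e₀) ^ (k + 2))) :=
          hseg.trans (mul_le_mul_of_nonneg_left (mul_le_mul_of_nonneg_left (by exact_mod_cast h3) (norm_nonneg _)) (abs_nonneg _))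
      _ ≤ e₀ / 2 * (|δ| * (‖v‖ * ((k + 2) ! * B * (2 / e₀) ^ (k + 2)))) * (2 / max (|x 0| - |δ|) (2 * e₀ / 2)) :=
          le_envelope_of_le he _ hx
      _ = _ := by ring
  · obtain ⟨h1, h2⟩ := lt_norm_and_lt_norm_shift_of_lt (lt_of_not_ge hx)
    rw [iteratedFDeriv_fbDir_bgmCutoffC_eq_zero_of_gt he v h2, iteratedFDeriv_fbDir_bgmCutoffC_eq_zero_of_gt he v h1, sub_zero,
      norm_zero]
    have : 0 < max (|x 0| - |δ|) (2 * e₀ / 2) := lt_max_of_lt_right (by linarith)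
    positivity

end Literature.MathematicalPhysics.QuantumLattice

end
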